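import Summits.AtomisticToContinuum.HydrodynamicLimit.Theorems.CellForecastPressureDecay.Negative.PerParticle

/-!
# `CellForecastPressureDecay`: isolated particles never thermalise — the cylinder-event lower bound

Negative-side infrastructure for the crux `AntiMazurCoboundaries.CellForecastPressureDecay`
(stmt-AtomisticToContinuum-13915), from `Cruxes/CellForecastPressureDecay/Disproof.lean` § 9
(seat refuter-cdisprove-stmt-AtomisticToContinuum-13915-g2-0, cycle 2); consumed by
`Negative/FixedRange.lean` (the fixed-range variant of the crux is false).

* Lattice cells of side `ℓ`, indexed by `Fin 3 → Fin m`, with CORES of side `ℓ - R` (`cellCore`): points in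
  the cores of distinct cells are `> R` apart (`lt_norm_sub_of_mem_cellCore`), cores lie in `[0, mℓ]³`.
* On the event "particle `i` in the core of cell `φ i`" for an injective assignment `φ : Fin n ↪ cells`,
  every range-`R` cluster is a singleton (`card_rangeCluster_le_one_of_mem_cellCore`), the configuration is
  in the hard-sphere domain once `σ ≤ R` (`mem_hardSphereDomain_of_mem_cellCore`), distinct assignments give
  disjoint events (`eq_of_mem_cellCore_of_mem_cellCore`).
* EXACT VALUE of the event's contribution to `∫⁻ e^{2∑ g(v_i)} dP_{n,L}`, `L = mℓ`:
  `Z⁻¹ ((ℓ-R)³ ∫ M e^{2g})ⁿ` (`lintegral_isoEvent`: the canonical density factorises on the cylinder event,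
  Fubini on `Config n`); `Z ≤ (L³)ⁿ` (`canonicalPartition_cell_le`).
* DOMINATION (`sum_indicator_le_cruxIntegrand`): the sum over all assignments of these integrands is below
  the crux integrand at `c = 1` and EVERY horizon `T` (free flight of singleton clusters,
  `Negative/LoneParticle.lean`).
The technique (assign particles to lattice cells, free flight, factorise) is reusable for any static LOWER
bound on the crux functional.
-/

open MeasureTheory Set Metric Filter ProbabilityTheory
open scoped ENNReal InnerProductSpace
open Literature.Analysis.FluidPDE Literature.MathematicalPhysics.KineticTheory

namespace Summit.AtomisticToContinuum.HydrodynamicLimit.Theorems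

noncomputable section

namespace CellForecastPressureDecay

/-! ## § 9a Lattice cells, cores, and the isolated-particles events -/

section FixedRange

/-- The CORE of the lattice cell `q ∈ (Fin 3 → Fin m)` of side `ℓ` with margin `R`: the open box
`Π_k (q_k ℓ, q_k ℓ + (ℓ - R))`. Points in cores of distinct cells are `> R` apart. -/
def cellCore (ℓ R : ℝ) {m : ℕ} (q : Fin 3 → Fin m) : Set V3 :=
  {x : V3 | ∀ k, ((q k : ℕ) : ℝ) * ℓ < x k ∧ x k < ((q k : ℕ) : ℝ) * ℓ + (ℓ - R)}

/-- A cell core is the preimage of an open coordinate box under `WithLp.ofLp`. [folklore] -/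
theorem cellCore_eq_preimage (ℓ R : ℝ) {m : ℕ} (q : Fin 3 → Fin m) :
    cellCore ℓ R q = (WithLp.ofLp : V3 → (Fin 3 → ℝ)) ⁻¹'
      Set.univ.pi (fun k => Set.Ioo (((q k : ℕ) : ℝ) * ℓ) (((q k : ℕ) : ℝ) * ℓ + (ℓ - R))) := by
  ext x
  simp [cellCore]

/-- Cell cores are measurable. [folklore] -/
theorem measurableSet_cellCore (ℓ R : ℝ) {m : ℕ} (q : Fin 3 → Fin m) : MeasurableSet (cellCore ℓ R q) := by
  rw [cellCore_eq_preimage]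
  exact (MeasurableSet.univ_pi fun _ => measurableSet_Ioo).preimage
    (PiLp.volume_preserving_ofLp (Fin 3)).measurable

/-- The volume of a cell core is `(ℓ - R)³` (for `R ≤ ℓ`). [folklore] -/
theorem volume_cellCore {ℓ R : ℝ} (hRℓ : R ≤ ℓ) {m : ℕ} (q : Fin 3 → Fin m) :
    volume (cellCore ℓ R q) = ENNReal.ofReal ((ℓ - R) ^ 3) := by
  rw [cellCore_eq_preimage, (PiLp.volume_preserving_ofLp (Fin 3)).measure_preimage
      (MeasurableSet.univ_pi fun _ => measurableSet_Ioo).nullMeasurableSet, Real.volume_pi_Ioo]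
  simp only [add_sub_cancel_left, Finset.prod_const, Finset.card_univ, Fintype.card_fin]
  rw [ENNReal.ofReal_pow (by linarith)]

/-- Points in the cores of two distinct cells are more than `R` apart (in some coordinate, hence in
norm). [folklore] -/
theorem lt_norm_sub_of_mem_cellCore {ℓ R : ℝ} (hℓ : 0 ≤ ℓ) {m : ℕ} {q q' : Fin 3 → Fin m} (hqq' : q ≠ q')
    {x y : V3} (hx : x ∈ cellCore ℓ R q) (hy : y ∈ cellCore ℓ R q') : R < ‖x - y‖ := by
  obtain ⟨k, hk⟩ := Function.ne_iff.1 hqq'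
  have h1 := hx k
  have h2 := hy k
  refine lt_of_lt_of_le ?_ (abs_apply_sub_apply_le x y k)
  have hk' : (q k : ℕ) ≠ (q' k : ℕ) := fun h => hk (Fin.ext h)
  rcases lt_or_gt_of_ne hk' with h | h
  · have h3 : ((q k : ℕ) : ℝ) + 1 ≤ ((q' k : ℕ) : ℝ) := by exact_mod_cast h
    have h4 : ((q k : ℕ) : ℝ) * ℓ + ℓ ≤ ((q' k : ℕ) : ℝ) * ℓ := by nlinarith
    refine lt_abs.2 (Or.inr ?_)
    linarith [h1.2, h2.1]
  · have h3 : ((q' k : ℕ) : ℝ) + 1 ≤ ((q k : ℕ) : ℝ) := by exact_mod_cast h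
    have h4 : ((q' k : ℕ) : ℝ) * ℓ + ℓ ≤ ((q k : ℕ) : ℝ) * ℓ := by nlinarith
    refine lt_abs.2 (Or.inl ?_)
    linarith [h1.1, h2.2]

/-- A cell core lies inside the cube `[0, m ℓ]³`. [folklore] -/
theorem cellCore_subset_cellCube {ℓ R : ℝ} (hℓ : 0 ≤ ℓ) (hR : 0 ≤ R) {m : ℕ} (q : Fin 3 → Fin m) :
    cellCore ℓ R q ⊆ cellCube ((m : ℝ) * ℓ) := by
  intro x hx k
  have h := hx k
  have hq0 : (0 : ℝ) ≤ ((q k : ℕ) : ℝ) := Nat.cast_nonneg _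
  have hq1 : ((q k : ℕ) : ℝ) + 1 ≤ (m : ℝ) := by exact_mod_cast (q k).isLt
  have hq2 : ((q k : ℕ) : ℝ) * ℓ + ℓ ≤ (m : ℝ) * ℓ := by nlinarith
  have hq3 : (0 : ℝ) ≤ ((q k : ℕ) : ℝ) * ℓ := mul_nonneg hq0 hℓ
  constructor
  · linarith [h.1]
  · linarith [h.2]

variable {n m : ℕ}

/-- On the isolated-particles event of an injective cell assignment `φ` (particle `i` in the core of
cell `φ i`), every range-`R` cluster is a singleton. [folklore] -/
theorem card_rangeCluster_le_one_of_mem_cellCore {ℓ R : ℝ} (hℓ : 0 ≤ ℓ) (φ : Fin n ↪ (Fin 3 → Fin m))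
    {z : Config n (Fin 3) V3} (hz : ∀ i, (z i).1 ∈ cellCore ℓ R (φ i)) (i : Fin n) :
    (rangeCluster (Euclidean.geometry (Fin 3)) R z i).card ≤ 1 := by
  have key : ∀ j ∈ rangeCluster (Euclidean.geometry (Fin 3)) R z i, j = i := by
    intro j hj
    rcases mem_rangeCluster.1 hj with h | h
    · exact h
    · by_contra hji
      have hne : φ i ≠ φ j := fun h' => hji (φ.injective h').symm
      have := lt_norm_sub_of_mem_cellCore hℓ hne (hz i) (hz j)
      rw [Euclidean.geometry_sepVec] at h
      linarith
  exact Finset.card_le_one.2 fun a ha b hb => by rw [key a ha, key b hb]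

/-- The isolated-particles event lies in the hard-sphere domain as soon as `σ ≤ R`. [folklore] -/
theorem mem_hardSphereDomain_of_mem_cellCore {ℓ R σ : ℝ} (hℓ : 0 ≤ ℓ) (hσR : σ ≤ R)
    (φ : Fin n ↪ (Fin 3 → Fin m)) {z : Config n (Fin 3) V3} (hz : ∀ i, (z i).1 ∈ cellCore ℓ R (φ i)) :
    z ∈ hardSphereDomain (Euclidean.geometry (Fin 3)) n σ := by
  rw [mem_hardSphereDomain]
  intro i j hij
  rw [Euclidean.geometry_sepVec]
  have hne : φ i ≠ φ j := fun h' => hij (φ.injective h')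
  exact hσR.trans (lt_norm_sub_of_mem_cellCore hℓ hne (hz i) (hz j)).le

/-- Distinct injective assignments give disjoint isolated-particles events (for `R ≥ 0`). [folklore] -/
theorem eq_of_mem_cellCore_of_mem_cellCore {ℓ R : ℝ} (hℓ : 0 ≤ ℓ) (hR : 0 ≤ R) {φ ψ : Fin n ↪ (Fin 3 → Fin m)}
    {z : Config n (Fin 3) V3} (hφ : ∀ i, (z i).1 ∈ cellCore ℓ R (φ i)) (hψ : ∀ i, (z i).1 ∈ cellCore ℓ R (ψ i)) :
    φ = ψ := by
  ext i : 1
  by_contra hne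
  have := lt_norm_sub_of_mem_cellCore hℓ hne (hφ i) (hψ i)
  rw [sub_self, norm_zero] at this
  linarith

/-- The isolated-particles event is measurable. [folklore] -/
theorem measurableSet_isoEvent (ℓ R : ℝ) (φ : Fin n ↪ (Fin 3 → Fin m)) :
    MeasurableSet {z : Config n (Fin 3) V3 | ∀ i, (z i).1 ∈ cellCore ℓ R (φ i)} := by
  have : {z : Config n (Fin 3) V3 | ∀ i, (z i).1 ∈ cellCore ℓ R (φ i)} =
      ⋂ i, (fun z : Config n (Fin 3) V3 => (z i).1) ⁻¹' cellCore ℓ R (φ i) := by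
    ext z; simp
  rw [this]
  exact MeasurableSet.iInter fun i => (measurableSet_cellCore ℓ R (φ i)).preimage (measurable_pi_apply i).fst

/-- The one-particle factor of the isolated-particles integrand. -/
def isoFactor (ℓ R : ℝ) (q : Fin 3 → Fin m) (g : V3 → ℝ) (p : V3 × V3) : ℝ :=
  (cellCore ℓ R q).indicator (fun _ => (1 : ℝ)) p.1 * (globalMaxwellian p.2 * Real.exp (2 * g p.2))

/-- The one-particle factor is nonnegative. [folklore] -/
theorem isoFactor_nonneg (ℓ R : ℝ) (q : Fin 3 → Fin m) (g : V3 → ℝ) (p : V3 × V3) :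
    0 ≤ isoFactor ℓ R q g p :=
  mul_nonneg (Set.indicator_nonneg (fun _ _ => zero_le_one) _)
    (mul_nonneg (globalMaxwellian_pos p.2).le (Real.exp_pos _).le)

/-- `M · e^{2g}` is Lebesgue integrable for bounded continuous `g`. [folklore] -/
theorem integrable_maxwellian_mul_exp {g : V3 → ℝ} (hg : Continuous g) {κ : ℝ} (hgb : ∀ v, |g v| ≤ κ) :
    Integrable fun v : V3 => globalMaxwellian v * Real.exp (2 * g v) := by
  refine integrable_globalMaxwellian.mul_bdd (c := Real.exp (2 * κ))
    (continuous_const.mul hg).rexp.aestronglyMeasurable (Eventually.of_forall fun v => ?_)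
  rw [Real.norm_eq_abs, abs_of_pos (Real.exp_pos _)]
  refine Real.exp_le_exp.2 ?_
  have := hgb v
  rw [abs_le] at this
  linarith [this.2]

/-- The one-particle factor is integrable on `V3 × V3`. [folklore] -/
theorem integrable_isoFactor (ℓ R : ℝ) (q : Fin 3 → Fin m) {g : V3 → ℝ} (hg : Continuous g) {κ : ℝ}
    (hgb : ∀ v, |g v| ≤ κ) : Integrable (isoFactor ℓ R q g) := by
  have h1 : Integrable (fun x : V3 => (cellCore ℓ R q).indicator (fun _ => (1 : ℝ)) x) := by
    rw [integrable_indicator_iff (measurableSet_cellCore ℓ R q)]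
    refine integrableOn_const ?_
    rw [cellCore_eq_preimage, (PiLp.volume_preserving_ofLp (Fin 3)).measure_preimage
      (MeasurableSet.univ_pi fun _ => measurableSet_Ioo).nullMeasurableSet, Real.volume_pi_Ioo]
    exact (ENNReal.prod_lt_top fun _ _ => ENNReal.ofReal_lt_top).ne
  have h := h1.mul_prod (integrable_maxwellian_mul_exp hg hgb)
  rw [← Measure.volume_eq_prod] at h
  exact h

/-- `∫ isoFactor = (ℓ - R)³ · ∫ M e^{2g}`. [folklore] -/
theorem integral_isoFactor {ℓ R : ℝ} (hRℓ : R ≤ ℓ) (q : Fin 3 → Fin m) (g : V3 → ℝ) :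
    ∫ p, isoFactor ℓ R q g p = (ℓ - R) ^ 3 * ∫ v, globalMaxwellian v * Real.exp (2 * g v) := by
  unfold isoFactor
  rw [Measure.volume_eq_prod, integral_prod_mul (μ := volume) (ν := volume)
      (fun x : V3 => (cellCore ℓ R q).indicator (fun _ => (1 : ℝ)) x)
      (fun v : V3 => globalMaxwellian v * Real.exp (2 * g v)),
    integral_indicator_const _ (measurableSet_cellCore ℓ R q), smul_eq_mul, mul_one, Measure.real,
    volume_cellCore hRℓ, ENNReal.toReal_ofReal (pow_nonneg (by linarith) 3)]

/-- `Z ≤ (L³)ⁿ`: the cell partition function is at most the free one. [folklore] -/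
theorem canonicalPartition_cell_le (σ : ℝ) {L : ℝ} (hL : 0 ≤ L) (n : ℕ) :
    canonicalPartition (Euclidean.geometry (Fin 3)) σ n (cellRef L) ≤ (L ^ 3) ^ n := by
  rw [canonicalPartition]
  have hint : Integrable ((hardSphereDomain (Euclidean.geometry (Fin 3)) n σ).indicator
      (tensorPow n (cellRef L))) :=
    (integrable_tensorPow n (integrable_cellRef L)).indicator
      (measurableSet_hardSphereDomain _ Euclidean.measurable_geometry_sepVec n σ)
  calc ∫ z, (hardSphereDomain (Euclidean.geometry (Fin 3)) n σ).indicator (tensorPow n (cellRef L)) z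
      ≤ ∫ z, tensorPow n (cellRef L) z :=
        integral_mono hint (integrable_tensorPow n (integrable_cellRef L))
          (Set.indicator_le_self' fun z _ => tensorPow_nonneg (cellRef_nonneg L) n z)
    _ = (∫ p, cellRef L p) ^ n := by
        simp only [tensorPow]
        rw [integral_fintype_prod_volume_eq_pow, Fintype.card_fin]
    _ = (L ^ 3) ^ n := by rw [integral_cellRef hL]

/-- **The isolated-particles lower bound, one assignment.** Under the cell law `P_{n,L}`, `L = mℓ`,
`σ ≤ R ≤ ℓ`, the contribution of the event "particle `i` in the core of cell `φ i`" to
`∫⁻ e^{2 ∑ g(v_i)} dP` is exactly `Z⁻¹ ((ℓ-R)³ ∫ M e^{2g})ⁿ`. [folklore] -/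
theorem lintegral_isoEvent {σ ℓ R L : ℝ} (hℓ : 0 ≤ ℓ) (hR : 0 ≤ R) (hσR : σ ≤ R) (hRℓ : R ≤ ℓ)
    (hL : L = (m : ℝ) * ℓ)
    (Φ : HardSphereFlow (Euclidean.geometry (Fin 3)) σ n) {g : V3 → ℝ} (hg : Continuous g) {κ : ℝ}
    (hgb : ∀ v, |g v| ≤ κ) (φ : Fin n ↪ (Fin 3 → Fin m)) :
    ∫⁻ z, {z : Config n (Fin 3) V3 | ∀ i, (z i).1 ∈ cellCore ℓ R (φ i)}.indicator
        (fun z => ENNReal.ofReal (Real.exp (2 * ∑ i, g (z i).2))) z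
        ∂(particleLaw Φ (canonicalDensity (Euclidean.geometry (Fin 3)) σ n (cellRef L))) =
      ENNReal.ofReal ((canonicalPartition (Euclidean.geometry (Fin 3)) σ n (cellRef L))⁻¹ *
        ((ℓ - R) ^ 3 * ∫ v, globalMaxwellian v * Real.exp (2 * g v)) ^ n) := by
  have hLdef := hL
  set Z : ℝ := canonicalPartition (Euclidean.geometry (Fin 3)) σ n (cellRef L) with hZdef
  set D := hardSphereDomain (Euclidean.geometry (Fin 3)) n σ with hDdef
  set S : Set (Config n (Fin 3) V3) := {z | ∀ i, (z i).1 ∈ cellCore ℓ R (φ i)} with hSdef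
  have hSm : MeasurableSet S := measurableSet_isoEvent ℓ R φ
  have hZ0 : 0 ≤ Z := by
    rw [hZdef, canonicalPartition]
    exact integral_nonneg fun z => Set.indicator_nonneg (fun w _ => tensorPow_nonneg (cellRef_nonneg L) n w) z
  -- measurability of the density and of the integrand
  have hDm : MeasurableSet D := measurableSet_hardSphereDomain _ Euclidean.measurable_geometry_sepVec n σ
  have htp : Measurable (tensorPow n (cellRef L) : Config n (Fin 3) V3 → ℝ) :=
    Finset.measurable_prod _ fun i _ => (measurable_cellRef L).comp (measurable_pi_apply i)
  have hdens : Measurable fun z : Config n (Fin 3) V3 =>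
      ENNReal.ofReal (canonicalDensity (Euclidean.geometry (Fin 3)) σ n (cellRef L) z) :=
    ((htp.indicator hDm).const_mul _).ennreal_ofReal
  have hgsum : Continuous fun z : Config n (Fin 3) V3 => ∑ i, g (z i).2 :=
    continuous_finsetSum _ fun i _ => hg.comp ((continuous_apply i).snd)
  have hF₀ : Measurable fun z : Config n (Fin 3) V3 => ENNReal.ofReal (Real.exp (2 * ∑ i, g (z i).2)) :=
    (continuous_const.mul hgsum).rexp.measurable.ennreal_ofReal
  rw [particleLaw_eq, liouville_eq, lintegral_withDensity_eq_lintegral_mul _ hdens (hF₀.indicator hSm)]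
  -- the integrand vanishes off S ⊆ D
  have hSD : S ⊆ D := fun z hz => mem_hardSphereDomain_of_mem_cellCore hℓ hσR φ hz
  have hprod : ((fun z : Config n (Fin 3) V3 =>
      ENNReal.ofReal (canonicalDensity (Euclidean.geometry (Fin 3)) σ n (cellRef L) z)) *
        S.indicator fun z => ENNReal.ofReal (Real.exp (2 * ∑ i, g (z i).2))) =
      fun z => ENNReal.ofReal (Z⁻¹ * ∏ i, isoFactor ℓ R (φ i) g (z i)) := by
    funext z
    simp only [Pi.mul_apply]
    by_cases hz : z ∈ S
    · have hzD : z ∈ D := hSD hz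
      rw [indicator_of_mem hz, canonicalDensity, ← hZdef, ← hDdef, indicator_of_mem hzD,
        ← ENNReal.ofReal_mul (mul_nonneg (inv_nonneg.2 hZ0) (tensorPow_nonneg (cellRef_nonneg L) n z)),
        mul_assoc]
      congr 2
      rw [tensorPow, Finset.mul_sum, Real.exp_sum, ← Finset.prod_mul_distrib]
      refine Finset.prod_congr rfl fun i _ => ?_
      have hxi : (z i).1 ∈ cellCore ℓ R (φ i) := hz i
      have hxin : (z i).1 ∈ {x : V3 | ∀ k, x k ∈ Set.Icc (0 : ℝ) L} := by
        rw [hLdef]; exact cellCore_subset_cellCube hℓ hR (φ i) hxi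
      simp only [isoFactor, cellRef, indicator_of_mem hxin, indicator_of_mem hxi, one_mul]
    · rw [indicator_of_notMem hz, mul_zero]
      have : ∃ i, (z i).1 ∉ cellCore ℓ R (φ i) := by
        by_contra hall
        push Not at hall
        exact hz hall
      obtain ⟨i, hi⟩ := this
      rw [Finset.prod_eq_zero (Finset.mem_univ i) (by simp only [isoFactor, indicator_of_notMem hi, zero_mul]),
        mul_zero, ENNReal.ofReal_zero]
  have hsupp : Function.support (((fun z : Config n (Fin 3) V3 =>
      ENNReal.ofReal (canonicalDensity (Euclidean.geometry (Fin 3)) σ n (cellRef L) z)) *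
        S.indicator fun z => ENNReal.ofReal (Real.exp (2 * ∑ i, g (z i).2)))) ⊆ D := by
    intro z hz
    by_contra hzD
    have hzS : z ∉ S := fun h => hzD (hSD h)
    simp only [Function.mem_support, Pi.mul_apply, indicator_of_notMem hzS, mul_zero, ne_eq,
      not_true_eq_false] at hz
  rw [setLIntegral_eq_of_support_subset hsupp, hprod]
  -- now a product integral w.r.t. Lebesgue measure on the configuration space
  have hint : Integrable fun z : Config n (Fin 3) V3 => Z⁻¹ * ∏ i, isoFactor ℓ R (φ i) g (z i) := by
    have := Integrable.fintype_prod (ι := Fin n) (μ := fun _ => (volume : Measure (V3 × V3)))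
      (f := fun i => isoFactor ℓ R (φ i) g) fun i => integrable_isoFactor ℓ R (φ i) hg hgb
    rw [← volume_pi] at this
    exact this.const_mul _
  have hnn : 0 ≤ᵐ[volume] fun z : Config n (Fin 3) V3 => Z⁻¹ * ∏ i, isoFactor ℓ R (φ i) g (z i) :=
    Eventually.of_forall fun z => mul_nonneg (inv_nonneg.2 hZ0)
      (Finset.prod_nonneg fun i _ => isoFactor_nonneg ℓ R (φ i) g (z i))
  rw [← ofReal_integral_eq_lintegral_ofReal hint hnn, integral_const_mul]
  congr 2
  rw [integral_fintype_prod_volume_eq_prod (ι := Fin n) (fun i => isoFactor ℓ R (φ i) g)]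
  simp only [integral_isoFactor hRℓ, Finset.prod_const, Finset.card_univ, Fintype.card_fin]


/-- Measurability of the isolated-particles integrand `e^{2 ∑ g(v_i)}`. [folklore] -/
theorem measurable_expSum {g : V3 → ℝ} (hg : Continuous g) :
    Measurable fun z : Config n (Fin 3) V3 => ENNReal.ofReal (Real.exp (2 * ∑ i, g (z i).2)) :=
  (continuous_const.mul (continuous_finsetSum _ fun i _ =>
    hg.comp ((continuous_apply i).snd))).rexp.measurable.ennreal_ofReal

/-- **Domination**: the sum over injective cell assignments of the isolated-particles integrands is
below the crux integrand at `c = 1` — on the event of `φ` every range-`R` cluster is a singleton, so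
every forecast is free flight and the window average of `g` is `g(v_i)` at every horizon `T`; the
events are pairwise disjoint; off their union the sum vanishes. [folklore] -/
theorem sum_indicator_le_cruxIntegrand {σ ℓ R T : ℝ} (hℓ : 0 ≤ ℓ) (hR : 0 ≤ R) (hT : T ≠ 0)
    (Ψ : (k : ℕ) → HardSphereFlow (Euclidean.geometry (Fin 3)) σ k) (g : V3 → ℝ)
    (z : Config n (Fin 3) V3) :
    ∑ φ : Fin n ↪ (Fin 3 → Fin m), {z : Config n (Fin 3) V3 | ∀ i, (z i).1 ∈ cellCore ℓ R (φ i)}.indicator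
        (fun z => ENNReal.ofReal (Real.exp (2 * ∑ i, g (z i).2))) z ≤
      ENNReal.ofReal (Real.exp (2 * 1 * ∑ i : Fin n, T⁻¹ * ∫ t in (0 : ℝ)..T,
        g (localClusterState Ψ R t z i).2)) := by
  by_cases h : ∃ φ : Fin n ↪ (Fin 3 → Fin m), ∀ i, (z i).1 ∈ cellCore ℓ R (φ i)
  · obtain ⟨φ, hφ⟩ := h
    rw [Finset.sum_eq_single_of_mem φ (Finset.mem_univ _) (fun ψ _ hne => ?_)]
    · rw [indicator_of_mem (show z ∈ {z : Config n (Fin 3) V3 | ∀ i, (z i).1 ∈ cellCore ℓ R (φ i)} from hφ)]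
      have hcard : ∀ i, (rangeCluster (Euclidean.geometry (Fin 3)) R z i).card ≤ 1 :=
        card_rangeCluster_le_one_of_mem_cellCore hℓ φ hφ
      simp only [vel_localClusterState_of_card_le_one Ψ (hcard _), intervalIntegral.integral_const,
        sub_zero, smul_eq_mul, inv_mul_cancel_left₀ hT, mul_one, le_refl]
    · exact indicator_of_notMem (fun hψ : ∀ i, (z i).1 ∈ cellCore ℓ R (ψ i) =>
        hne (eq_of_mem_cellCore_of_mem_cellCore hℓ hR hψ hφ)) _
  · push Not at h
    have h0 : ∀ φ : Fin n ↪ (Fin 3 → Fin m), {z : Config n (Fin 3) V3 | ∀ i, (z i).1 ∈ cellCore ℓ R (φ i)}.indicator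
        (fun z => ENNReal.ofReal (Real.exp (2 * ∑ i, g (z i).2))) z = 0 := fun φ => by
      obtain ⟨i, hi⟩ := h φ
      exact indicator_of_notMem (fun hφ : ∀ i, (z i).1 ∈ cellCore ℓ R (φ i) => hi (hφ i)) _
    rw [Finset.sum_eq_zero fun φ _ => h0 φ]
    exact bot_le


end FixedRange

end CellForecastPressureDecay

end

end Summit.AtomisticToContinuum.HydrodynamicLimit.Theorems
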